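import Mathlib.NumberTheory.NumberField.Units.DirichletTheorem
import HarnessLib

/-!
# Reduction of archimedean vectors by global units (Dirichlet's unit theorem, idelic form)

Trunk `AutomorphicAxiomatic` (G19), topic `NumberTheory/Automorphic`; namespace `Literature.Automorphic`.

Let `K` be a number field.  Dirichlet's unit theorem in Mathlib's form says that the logarithmic
embedding `ε ↦ (mult w · log |ε|_w)_{w ≠ w₀}` maps `(𝓞 K)ˣ` onto a full lattice
`NumberField.Units.unitLattice K` of `ℝ^{r₁ + r₂ - 1}` (`instZLattice_unitLattice`).  We deduce the
form in which the unit theorem enters the compactness of the norm-one idele class group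
`J_K^1 / Kˣ` (Cassels–Fröhlich, Ch. II §16 Theorem, via the "more usual" route of §18, closing
remark): **for every `c > 0` there are bounds `0 < r ≤ R` such that every vector of positive reals
`(u_w)_{w ∣ ∞}` with `∏_w u_w ^ mult w = c` can be multiplied by a global unit `ε⁻¹` so that all the
components `u_w |ε⁻¹|_w` lie in `[r, R]`** (`exists_pos_bounds_forall_exists_unit`).  The proof: a
bounded fundamental domain for the unit lattice (Mathlib `ZSpan.fract`, `ZSpan.norm_fract_le` for
the basis `NumberField.Units.basisUnitLattice`) controls the coordinates `w ≠ w₀`, and the relation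
`∑_w mult w · log u_w = log c` together with `∑_w mult w · log |ε|_w = 0`
(Mathlib `NumberField.Units.sum_mult_mul_log`) controls the remaining coordinate `w₀`.

## Main results

* `exists_unit_logEmbedding_sub_le` : every `h ∈ ℝ^{\{w ≠ w₀\}}` is within a uniform sup-distance
  `C` of the logarithmic embedding of a unit.
* `exists_pos_bounds_forall_exists_unit` : the reduction statement above.

## References

* J. W. S. Cassels, A. Fröhlich (eds.), *Algebraic Number Theory* (1967), Ch. II (Cassels,
  *Global fields*) §18, Theorem (unit theorem: `Λ = λ(H_S)` is a lattice in the trace-zero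
  hyperplane `T`, `T/Λ` compact) and closing remark. [CasselsFrohlichANT1967]
-/

noncomputable section

open NumberField NumberField.InfinitePlace NumberField.Units NumberField.Units.dirichletUnitTheorem

namespace Literature.NumberTheory.Automorphic

variable (K : Type*) [Field K] [NumberField K]

/-- **A bounded fundamental domain for the unit lattice.**  There is `C ≥ 0` such that every
vector `h ∈ ℝ^{\{w ≠ w₀\}}` (Mathlib's `logSpace K`) is within sup-distance `C` of the logarithmic
embedding `(mult w · log |ε|_w)_{w ≠ w₀}` of some unit `ε ∈ (𝓞 K)ˣ`: the unit lattice is a full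
`ℤ`-lattice (Mathlib `NumberField.Units.instZLattice_unitLattice`, Dirichlet's theorem), so
`h - ⌊h⌋_B` lies in the bounded fundamental parallelotope of the basis `B = basisUnitLattice K`
(Mathlib `ZSpan.fract`, `ZSpan.norm_fract_le`).  Cassels–Fröhlich, Ch. II §18, Theorem
(`T/Λ` is compact). [cite: CasselsFrohlichANT1967, Ch. II §18 Theorem (unit theorem)] -/
theorem exists_unit_logEmbedding_sub_le :
    ∃ C : ℝ, 0 ≤ C ∧ ∀ h : logSpace K, ∃ ε : (𝓞 K)ˣ, ∀ w : {w : InfinitePlace K // w ≠ w₀},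
      |h w - logEmbedding K (Additive.ofMul ε) w| ≤ C := by
  classical
  let B := (basisUnitLattice K).ofZLatticeBasis ℝ (unitLattice K)
  refine ⟨∑ i, ‖B i‖, Finset.sum_nonneg fun i _ => norm_nonneg _, fun h => ?_⟩
  have hmem : (ZSpan.floor B h : logSpace K) ∈ unitLattice K := by
    rw [← (basisUnitLattice K).ofZLatticeBasis_span ℝ (unitLattice K)]
    exact (ZSpan.floor B h).2
  obtain ⟨x, -, hx⟩ := Submodule.mem_map.1 (show (ZSpan.floor B h : logSpace K) ∈
    Submodule.map (logEmbedding K).toIntLinearMap ⊤ from hmem)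
  refine ⟨Additive.toMul x, fun w => ?_⟩
  have hxw : logEmbedding K (Additive.ofMul (Additive.toMul x)) w =
      (ZSpan.floor B h : logSpace K) w := by
    rw [ofMul_toMul, ← hx]
    rfl
  calc |h w - logEmbedding K (Additive.ofMul (Additive.toMul x)) w|
        = ‖ZSpan.fract B h w‖ := by
          rw [hxw, ZSpan.fract_apply, Pi.sub_apply, Real.norm_eq_abs]
    _ ≤ ‖ZSpan.fract B h‖ := norm_le_pi_norm _ w
    _ ≤ ∑ i, ‖B i‖ := ZSpan.norm_fract_le B h

/-- **Reduction of positive archimedean vectors by units (idelic unit theorem).**  For every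
real `c` (only `c > 0` is of interest) there are `0 < r` and `R` such that for every family of
positive reals `(u_w)_{w ∣ ∞}` with `∏_w u_w ^ mult w = c` there is a unit `ε ∈ (𝓞 K)ˣ` with
`r ≤ u_w · |ε⁻¹|_w ≤ R` for every infinite place `w`.  (With `u_w = |y_w|_w` for an idele `y`
integral-unit at all finite places, this says `y ε⁻¹` lies in a fixed compact box; it is the
unit-theorem input to the compactness of `J_K^1 / Kˣ`, Cassels–Fröhlich Ch. II §16 Theorem via
the §18 closing remark "It is more usual to deduce the compactness of `J_k^1/kˣ` from these
theorems".)  Proof: `exists_unit_logEmbedding_sub_le` bounds `|log u_w - log |ε|_w|` for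
`w ≠ w₀`; the coordinate `w₀` is bounded using `∑_w mult w log u_w = log c` and
`∑_w mult w log |ε|_w = 0` (Mathlib `sum_mult_mul_log`).
[cite: CasselsFrohlichANT1967, Ch. II §18 Theorem (unit theorem) and closing remark] -/
theorem exists_pos_bounds_forall_exists_unit (c : ℝ) :
    ∃ r R : ℝ, 0 < r ∧ ∀ u : InfinitePlace K → ℝ, (∀ w, 0 < u w) →
      ∏ w, u w ^ w.mult = c →
        ∃ ε : (𝓞 K)ˣ, ∀ w : InfinitePlace K,
          r ≤ u w * w (algebraMap (𝓞 K) K ((ε⁻¹ : (𝓞 K)ˣ) : 𝓞 K)) ∧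
            u w * w (algebraMap (𝓞 K) K ((ε⁻¹ : (𝓞 K)ˣ) : 𝓞 K)) ≤ R := by
  classical
  obtain ⟨C, hC0, hC⟩ := exists_unit_logEmbedding_sub_le K
  set D : ℝ := |Real.log c| + (Fintype.card {w : InfinitePlace K // w ≠ w₀}) * C + C with hD
  refine ⟨Real.exp (-D), Real.exp D, Real.exp_pos _, fun u hu hprod => ?_⟩
  obtain ⟨ε, hε⟩ := hC fun w => (w.1.mult : ℝ) * Real.log (u w.1)
  refine ⟨ε, fun w => ?_⟩
  have hεpos : ∀ w : InfinitePlace K, 0 < w (algebraMap (𝓞 K) K ε) := fun w =>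
    Units.pos_at_place ε w
  -- the differences `d w = log u_w - log |ε|_w`
  set d : InfinitePlace K → ℝ := fun w =>
    Real.log (u w) - Real.log (w (algebraMap (𝓞 K) K ε)) with hd
  -- coordinates `w ≠ w₀`
  have h1' : ∀ w : {w : InfinitePlace K // w ≠ w₀}, |(w.1.mult : ℝ) * d w.1| ≤ C := by
    intro w
    have h := hε w
    simp only [logEmbedding_component] at h
    rwa [← mul_sub] at h
  have h1 : ∀ w : {w : InfinitePlace K // w ≠ w₀}, |d w.1| ≤ C := by
    intro w
    have h := h1' w
    rw [abs_mul, Nat.abs_cast] at h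
    have hm : (1 : ℝ) ≤ w.1.mult := one_le_mult
    calc |d w.1| = 1 * |d w.1| := (one_mul _).symm
      _ ≤ (w.1.mult : ℝ) * |d w.1| := by gcongr
      _ ≤ C := h
  -- the sum relation
  have hsum : ∑ w : InfinitePlace K, (w.mult : ℝ) * d w = Real.log c := by
    have hu' : ∑ w : InfinitePlace K, (w.mult : ℝ) * Real.log (u w) = Real.log c := by
      rw [← hprod, Real.log_prod (fun w _ => pow_ne_zero _ (hu w).ne')]
      exact Finset.sum_congr rfl fun w _ => (Real.log_pow _ _).symm
    have hε' := sum_mult_mul_log ε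
    simp only [hd, mul_sub, Finset.sum_sub_distrib, hu', hε', sub_zero]
  -- coordinate `w₀`
  have h0 : |d w₀| ≤ |Real.log c| + (Fintype.card {w : InfinitePlace K // w ≠ w₀}) * C := by
    rw [Fintype.sum_eq_add_sum_subtype_ne _ w₀] at hsum
    have hm : (1 : ℝ) ≤ (w₀ : InfinitePlace K).mult := one_le_mult
    have hbound : |∑ w : {w : InfinitePlace K // w ≠ w₀}, (w.1.mult : ℝ) * d w.1| ≤
        (Fintype.card {w : InfinitePlace K // w ≠ w₀}) * C := by
      calc |∑ w : {w : InfinitePlace K // w ≠ w₀}, (w.1.mult : ℝ) * d w.1|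
          ≤ ∑ w : {w : InfinitePlace K // w ≠ w₀}, |(w.1.mult : ℝ) * d w.1| :=
            Finset.abs_sum_le_sum_abs _ _
        _ ≤ ∑ _w : {w : InfinitePlace K // w ≠ w₀}, C := Finset.sum_le_sum fun w _ => h1' w
        _ = (Fintype.card {w : InfinitePlace K // w ≠ w₀}) * C := by
            rw [Finset.sum_const, Finset.card_univ, nsmul_eq_mul]
    have heq : ((w₀ : InfinitePlace K).mult : ℝ) * d w₀ =
        Real.log c - ∑ w : {w : InfinitePlace K // w ≠ w₀}, (w.1.mult : ℝ) * d w.1 := by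
      linarith
    calc |d w₀| = 1 * |d w₀| := (one_mul _).symm
      _ ≤ ((w₀ : InfinitePlace K).mult : ℝ) * |d w₀| := by gcongr
      _ = |((w₀ : InfinitePlace K).mult : ℝ) * d w₀| := by rw [abs_mul, Nat.abs_cast]
      _ = |Real.log c - ∑ w : {w : InfinitePlace K // w ≠ w₀}, (w.1.mult : ℝ) * d w.1| := by
          rw [heq]
      _ ≤ |Real.log c| + |∑ w : {w : InfinitePlace K // w ≠ w₀}, (w.1.mult : ℝ) * d w.1| :=
          abs_sub _ _
      _ ≤ _ := by linarith
  -- all coordinates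
  have hall : |d w| ≤ D := by
    have hcard : (0 : ℝ) ≤ (Fintype.card {w : InfinitePlace K // w ≠ w₀}) * C :=
      mul_nonneg (Nat.cast_nonneg _) hC0
    by_cases hw : w = w₀
    · subst hw; linarith
    · have := h1 ⟨w, hw⟩
      linarith [abs_nonneg (Real.log c)]
  -- translate back
  have hinv : w (algebraMap (𝓞 K) K ((ε⁻¹ : (𝓞 K)ˣ) : 𝓞 K)) = (w (algebraMap (𝓞 K) K ε))⁻¹ := by
    rw [← map_inv₀]
    congr 1
    exact map_units_inv (algebraMap (𝓞 K) K) ε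
  have hz : u w * w (algebraMap (𝓞 K) K ((ε⁻¹ : (𝓞 K)ˣ) : 𝓞 K)) = Real.exp (d w) := by
    rw [hinv, hd, Real.exp_sub, Real.exp_log (hu w), Real.exp_log (hεpos w), div_eq_mul_inv]
  rw [hz, Real.exp_le_exp, Real.exp_le_exp]
  exact ⟨by linarith [neg_abs_le (d w)], (le_abs_self _).trans hall⟩

end Literature.NumberTheory.Automorphic
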